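import Summits.ResolutionOfSingularities.ResolutionOfSingularities.Theorems.PurelyInseparableDim4ResConePowerConeTailDiagRawSigma
import Summits.ResolutionOfSingularities.ResolutionOfSingularities.Theorems.PurelyInseparableDim4ResConeLossFreeTwins
import Summits.ResolutionOfSingularities.ResolutionOfSingularities.Theorems.PurelyInseparableDim4ResConeWeightsPresentation
import Summits.ResolutionOfSingularities.ResolutionOfSingularities.Theorems.PurelyInseparableDim4ResConePowerConeFormSupport
import HarnessLib
import HarnessLib.Audit.Tags

/-!
# Purely inseparable four-folds — POWER-CONE TAILS, THE LOSS-FREE T-SECTOR ROW REDUCES TO THE TWIN WITH TWO FREE LETTERS: a loss-free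
# power-cone tail with a late T-sector time has, from some time on, the frozen boundary `n·a + n·a′` with `n + d = p` — every prime
# (cell `res-dim4-pi`, K2(p) lane, B rows, row B-LF; seat res-dim4-p-1 g7)

[OURS · counted 0 · cell `res-dim4-pi` · K2(p) lane (holder res-dim4-p-12 g5, e = 3 map 13:55Z).  STRUCTURE THEOREM by composition, CITED
BY NAME: res-dim4-p-2 g6's frozen twins `ResCone.lossfree_frozen_twins` (loss-free constant-shade tail ⇒ weights frozen with ≥ 2 active
letters of the newborn weight) and this lineage's σ-links `ResCone.no_powerCone_tail_sigma_raw` (every T-sector σ = (n, n) + w, `w ≥ 1`: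
class (i) p723209 over res-dim4-p-7 g6's two-slot game, diagonal over res-dim4-p-5 g6's drift theorem).]  Nothing here proves K2(p) for
any `p`, any TAIL(p, d, 3), `NoAboveFloorTrap p p` or resolution of singularities in dimension ≥ 4 / characteristic `p` — NOT proved.  AI
kernel work, weaker than expert review.  A statement about OUR frame's hypothetical `Step0 p` chains.

THE THEOREM **`lossfree_tSector_powerCone_tail_twin`**.  RAW package of the lane (isolated above-floor witnessed `Step0 p` chain, `x^{r₀} ∣ F₀`,
shade `d ≥ 2` and `e_G = 3` from `k₀`, polar kernels `ℓ k`) + LOSS-FREE from `k₀` (`b k i ≠ 0 → r_k i = 0`) + T-SECTOR beyond every time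
(`∀ k₁ ≥ k₀, ∃ k ≥ k₁, ∃ φ, r_k φ = 0 ∧ ℓ k φ ≠ 0`; the other branch of `powerCone_TL_dichotomy` is the L-sector, res-dim4-p-5's files) ⟹
`∃ K₁ ≥ k₀, ∃ n a a′`, `0 < n`, `n + d = p`, `a ≠ a′`, and `r_k = n·a + n·a′` for every `k ≥ K₁` — the HEAVY TWIN WITH TWO FREE LETTERS, i.e.
exactly the σ = (n, n) + 0 class (res-dim4-typ-1's class (ii)/(iii) port, Q-FLAG-conditional today).  PROOF: freeze the weights
(`lossfree_frozen_twins`: `r* = r_{K₁}`, active twins `a ≠ a′` of weight `n = |r*| + d − p ≥ 1`); a T-sector letter `φ` at a time `≥ K₁ + 1`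
has `r* φ = 0`; the fourth letter `u` carries `W := r* u`, so `r* = n·a + n·a′ + W·u` and `n + W + d = p` (band: `ord₀ = |r*| + d > p`);
if `W ≥ 1` this is a T-sector σ = (n, n) + W tail from `K₁` — impossible by `no_powerCone_tail_sigma_raw`; hence `W = 0`.
So after this file the loss-free e = 3 row of OUR frame is: eventually-L-sector tails (res-dim4-p-5 g6's
`lossfree_lSector_twin_weight_add_three_le` confines them to LIGHT twins `n + 3 ≤ d`; not killed here) ∪ T-sector class (ii)/(iii)
(res-dim4-typ-1 / res-dim4-p-3); the lossy rows (B-LOSSY) are untouched.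
[cite: CossartJannsenSaito2020, Thm. 3.14, Lemma 13.2] [cite: HauserPerlega2019PRIMS, §2 (transform D′ of D)] [cite: Hauser2010, §§F–G]
bears_on: LADDER-RESOLUTION:D157-DOOR2 (res-dim4-pi · K2(p) B-LF loss-free T-sector ⇒ twin with two free letters).  Supports
stmt-ResolutionOfSingularities-16155 (helper).
-/

set_option linter.dupNamespace false -- mandated namespace of this single-conjunct summit

noncomputable section

namespace Summit.ResolutionOfSingularities.ResolutionOfSingularities.Theorems.PIDim4
namespace ResCone

open MvPolynomial Finset
open Literature.AlgebraicGeometry.Resolution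
open Literature.AlgebraicGeometry.Resolution.CentreBlowup
open Literature.AlgebraicGeometry.Resolution.Hauser2010
open Literature.AlgebraicGeometry.Resolution.HauserPerlega2019

variable {K : Type} [Field K] [DecidableEq K]

/-- **A LOSS-FREE T-SECTOR POWER-CONE TAIL IS EVENTUALLY THE HEAVY TWIN WITH TWO FREE LETTERS, every prime** (module docstring):
`lossfree_frozen_twins` ∘ fourth-letter bookkeeping ∘ `no_powerCone_tail_sigma_raw` on the passive weight `W ≥ 1`. [OURS · composition]
[cite: CossartJannsenSaito2020, Thm. 3.14] -/
theorem lossfree_tSector_powerCone_tail_twin (p : ℕ) [Fact p.Prime] [CharP K p] {d : ℕ} (hd2 : 2 ≤ d) {c : ℕ → State K}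
    {j : ℕ → Fin 4} {b : ℕ → Fin 4 → K} (hc : ∀ k, IsIsolated p (c k).F ∧ Step0 p (c k) (c (k + 1)))
    (hwit : FreeTail.IsWitnessedChain p c j b) (hr0 : ∀ e ∈ (c 0).F.support, (c 0).r ≤ e)
    (hfloor : ∀ k, ordZero (c k).F ≠ p) {k₀ : ℕ} (hshade : ∀ k, k₀ ≤ k → (c k).shade = (d : ℕ∞))
    (he3 : ∀ k, k₀ ≤ k → Module.finrank K (resVertex (c k)) = 3)
    (hloss : ∀ k, k₀ ≤ k → ∀ i, b k i ≠ 0 → (c k).r i = 0)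
    {ℓ : ℕ → Fin 4 → K} (hℓV : ∀ k, k₀ ≤ k → ∀ u, u ∈ resVertex (c k) ↔ dotProduct (ℓ k) u = 0)
    (hT : ∀ k₁, k₀ ≤ k₁ → ∃ k, k₁ ≤ k ∧ ∃ φ, (c k).r φ = 0 ∧ ℓ k φ ≠ 0) :
    ∃ K₁ n : ℕ, ∃ a a' : Fin 4, k₀ ≤ K₁ ∧ 0 < n ∧ n + d = p ∧ a ≠ a' ∧
      ∀ k, K₁ ≤ k → (c k).r = Finsupp.single a n + Finsupp.single a' n := by
  classical
  -- (1) frozen weights with two active twins (p-2 g6)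
  obtain ⟨K₁, hK₁, hconst, -, a, a', haa', ha, ha'⟩ := lossfree_frozen_twins hc hwit hr0 hfloor hshade hloss
  set n : ℕ := (c K₁).r.degree + d - p with hn
  -- the band at `K₁`: `ord₀ = |r| + d > p`
  obtain ⟨o, ho, hpo, -⟩ := chain_band p hc hfloor K₁
  have hsh := hshade K₁ hK₁
  rw [BandShade.shade_eq_coe ho, Nat.cast_inj] at hsh
  have hod : o = (c K₁).r.degree + d := by omega
  have hn1 : 0 < n := by omega
  -- (2) a late T-sector letter `φ` has frozen weight `0`
  obtain ⟨kₑ, hkₑ, φ, hrφ, hℓφ⟩ := hT (K₁ + 1) (by omega)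
  have hrφ' : (c K₁).r φ = 0 := by rw [← hconst kₑ (by omega)]; exact hrφ
  have haφ : a ≠ φ := fun h => by rw [h, hrφ'] at ha; omega
  have ha'φ : a' ≠ φ := fun h => by rw [h, hrφ'] at ha'; omega
  -- (3) the fourth letter and the shape of the frozen boundary
  obtain ⟨u, hua, hua', huφ, hall⟩ := exists_fourth_letter haa' haφ ha'φ
  set W : ℕ := (c K₁).r u with hW
  have hshape : (c K₁).r = Finsupp.single a n + Finsupp.single a' n + Finsupp.single u W := by
    ext i
    rw [Finsupp.add_apply, Finsupp.add_apply]
    rcases hall i with h | h | h | h <;> rw [h]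
    · rw [Finsupp.single_eq_same, Finsupp.single_eq_of_ne haa', Finsupp.single_eq_of_ne hua.symm, ha]; ring
    · rw [Finsupp.single_eq_of_ne haa'.symm, Finsupp.single_eq_same, Finsupp.single_eq_of_ne hua'.symm, ha']; ring
    · rw [Finsupp.single_eq_of_ne haφ.symm, Finsupp.single_eq_of_ne ha'φ.symm, Finsupp.single_eq_of_ne huφ.symm, hrφ']; ring
    · rw [Finsupp.single_eq_of_ne hua, Finsupp.single_eq_of_ne hua', Finsupp.single_eq_same, hW]; ring
  have hdeg : (c K₁).r.degree = 2 * n + W := by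
    rw [hshape, map_add, map_add, Finsupp.degree_single, Finsupp.degree_single, Finsupp.degree_single]; ring
  have hσ : n + W + d = p := by omega
  -- (4) `W = 0`, else a T-sector σ = (n, n) + W tail from `K₁`
  by_cases hW0 : W = 0
  · refine ⟨K₁, n, a, a', hK₁, hn1, by omega, haa', fun k hk => ?_⟩
    rw [hconst k hk, hshape, hW0, Finsupp.single_zero, add_zero]
  · exfalso
    exact no_powerCone_tail_sigma_raw p hσ hn1 (Nat.pos_of_ne_zero hW0) hd2 hc hwit hr0 hfloor
      (fun k hk => hshade k (le_trans hK₁ hk)) (fun k hk => he3 k (le_trans hK₁ hk))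
      (fun k hk => ⟨a, a', u, haa', fun h => hua h.symm, fun h => hua' h.symm, by rw [hconst k hk, hshape]⟩)
      (fun k hk => hℓV k (le_trans hK₁ hk)) (show K₁ + 1 ≤ kₑ by omega) hrφ hℓφ

/-- **STRUCTURE OF A LOSS-FREE POWER-CONE TAIL, every prime** (`powerCone_TL_dichotomy` ∘ `lossfree_tSector_powerCone_tail_twin`): either the
tail is eventually in the L-SECTOR (every free letter killed by the form from some time on — res-dim4-p-5's light L-twins), or its boundary
freezes to the HEAVY TWIN `n·a + n·a′` with `n + d = p` (two free letters — res-dim4-typ-1's class (ii)/(iii)). [OURS · composition]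
[cite: CossartJannsenSaito2020, Thm. 3.14] -/
theorem lossfree_powerCone_tail_structure (p : ℕ) [Fact p.Prime] [CharP K p] {d : ℕ} (hd2 : 2 ≤ d) {c : ℕ → State K}
    {j : ℕ → Fin 4} {b : ℕ → Fin 4 → K} (hc : ∀ k, IsIsolated p (c k).F ∧ Step0 p (c k) (c (k + 1)))
    (hwit : FreeTail.IsWitnessedChain p c j b) (hr0 : ∀ e ∈ (c 0).F.support, (c 0).r ≤ e)
    (hfloor : ∀ k, ordZero (c k).F ≠ p) {k₀ : ℕ} (hshade : ∀ k, k₀ ≤ k → (c k).shade = (d : ℕ∞))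
    (he3 : ∀ k, k₀ ≤ k → Module.finrank K (resVertex (c k)) = 3)
    (hloss : ∀ k, k₀ ≤ k → ∀ i, b k i ≠ 0 → (c k).r i = 0)
    {ℓ : ℕ → Fin 4 → K} (hℓV : ∀ k, k₀ ≤ k → ∀ u, u ∈ resVertex (c k) ↔ dotProduct (ℓ k) u = 0) :
    (∃ k₁, k₀ ≤ k₁ ∧ ∀ k, k₁ ≤ k → ∀ i, (c k).r i = 0 → ℓ k i = 0) ∨
      (∃ K₁ n : ℕ, ∃ a a' : Fin 4, k₀ ≤ K₁ ∧ 0 < n ∧ n + d = p ∧ a ≠ a' ∧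
        ∀ k, K₁ ≤ k → (c k).r = Finsupp.single a n + Finsupp.single a' n) := by
  rcases powerCone_TL_dichotomy (c := c) (ℓ := ℓ) k₀ with hL | hT
  · exact Or.inl hL
  · exact Or.inr (lossfree_tSector_powerCone_tail_twin p hd2 hc hwit hr0 hfloor hshade he3 hloss hℓV hT)

end ResCone
end Summit.ResolutionOfSingularities.ResolutionOfSingularities.Theorems.PIDim4

end
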